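import Summits.ValiantsHypothesis.ValiantsHypothesis.Theses.LacunarySymmetroid
import Summits.ValiantsHypothesis.ValiantsHypothesis.Theorems.LacunarySymmetroidMatrixDescartesCensusRealExponentsSimplex
import Summits.ValiantsHypothesis.ValiantsHypothesis.Theorems.LacunarySymmetroidMatrixDescartesCensusRealExponentsLocus
import Summits.ValiantsHypothesis.ValiantsHypothesis.Theorems.LacunarySymmetroidMatrixDescartesDoorA26WallBubblingPureDSieve
import Summits.ValiantsHypothesis.ValiantsHypothesis.Theorems.LacunarySymmetroidMatrixDescartesDoorA26WallBubblingBubblingAssembly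

/-!
# Line `wall_bubbling` for the crux `DoorA26` (stmt-ValiantsHypothesis-19979) — inertia-closed bubbling at the walls of the exponent simplex

Crux (FIXED, the route's decl, targeted BY NAME): `Summit.ValiantsHypothesis.ValiantsHypothesis.Theses.LacunarySymmetroid.DoorA26`
(`= PosRootLawAt 2 6 19`; support item r9 of `route-ValiantsHypothesis-LacunarySymmetroid`; OPEN, typed, never asserted here).
Seat: val-idea-15 (g1, lens = finite, D-0154 b71 (C)); critic of record val-idea-crit-5.  UNREGISTERED line (ideator; no
`ledger skeleton check`).  Nothing in this file is proved about the crux: THREE `sorry`d obligations (W, M, R) + a kernel-checked composition;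
obligations (D) and (B) are landed theorems (`…Theorems.LacunarySymmetroidMatrixDescartes.WallBubbling.pureDSieve`, p610269;
`…Theorems.LacunarySymmetroidMatrixDescartes.WallBubbling.Bubbling.stub_bubbling_proof`, module `…WallBubblingBubblingAssembly` of the
9-module port p619647 = module 8 of the chain p618256 · p618583 · p617041 · p617256 · p618712 · p618841 · p619271 · p619386 · p619647) and their stubs are discharged by term (definitional bridge, no `sorry`); the companion
`pureDSieve_false_without_noMixed` certifies that (M) is genuinely second-order.  With (B)+(D) in the tree, `pureDisjointWalls_of` below is
UNCONDITIONAL: twenties do not accumulate at pure disjoint-pair walls of the sorted simplex — a structure theorem on the closure of the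
twenty-locus, NOT the door ((W), (M) law tier, (R) the residual door).

WHY THIS LINE.  Over REAL exponents the door is one compact problem (`Census.RealExp.doorA26_iff_simplex`): the open
twenty-locus `T ⊆ ℝ⁶` (`isOpen_twentyLocus_two_six`) must miss the sorted simplex `Δ = {0 = δ₀ ≤ ⋯ ≤ δ₅ = 1}`.  `Δ` is convex,
hence connected, and `T ∩ Δ` is relatively open; so `T ∩ Δ = ∅` as soon as `T ∩ Δ` is also relatively CLOSED and misses one
point — i.e. as soon as twenties cannot ACCUMULATE anywhere: not at the pair-sum WALLS of `Δ` (where `T` itself is already absent: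
`realRow_two_six_of_pairSum_eq`) and not inside the open Sidon chambers (`DoorA26_of`, kernel-checked below).  The NEW LEVER is
the accumulation analysis at a wall («bubbling»): for `m = 2` the determinant is a GRAM form, `det Σ x^{δₗ}Sₗ = Σᵢⱼ x^{δᵢ+δⱼ} Gᵢⱼ`
with `G = (polar det)(Sᵢ,Sⱼ)` the Gram matrix of the six letters in `(Sym₂ℝ, det) ≅ ℝ^{1,2}`, so `G` ranges over the CLOSED
cone `{inertia ≤ (1,2)} ∪ {inertia ≤ (2,1)}` (`Realisable`), invariant under the root-scale congruences `G ↦ D_λ G D_λ`,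
`D_λ = diag(λ^{δᵢ})`.  A sequence of twenties `δ^ν → δ* ∈` wall keeps 20 zeros only if, after clustering the log-roots and
rescaling, some cluster BLOWS UP (its first-order limit vanishes identically — otherwise Laguerre–Descartes for the limiting
(extended) exponential sums + Hurwitz give `≤ #{distinct pair sums at δ*} − 1 ≤ 19` zeros); the blow-up leaves a nonzero
`G⁰ ∈ Realisable` (closedness!) whose pair-sum VALUE CLASSES all sum to zero (`BlockSumsZero`) — a BLOW-UP PATTERN
(`Stmt.stub_bubbling`).  Whether a face of the pair-sum arrangement admits a blow-up pattern is a FINITE question about 6×6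
symmetric matrices of bounded inertia («face sieve») — theorem first, finite check second (lens = finite):
* PURE DISJOINT-PAIR faces (`δᵢ+δⱼ = δₖ+δₗ`, four distinct letters, no mixed/Weyl coincidence): NO pattern exists
  (`Stmt.stub_pureDSieve`; proof sketch in `Lines/wall_bubbling.md` §D: lone diagonal classes ⇒ `G⁰ᵢᵢ = 0` ⇒ all active letters
  are NULL (rank 1) ⇒ `G⁰ₖₗ = ±½·det[uₖ uₗ]²` ⇒ the top cross pair of two non-parallel active letters is alone in its value class ⇒
  contradiction; finite cross-check: the 23 pure-D faces of the (2,6) arrangement, 72 (sub-union, support) cases, 0 realisable,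
  `exp/sieveF.py`).  With bubbling this gives the PURE-DISJOINT WALL LAW `pureDisjointWalls_of` (kernel-checked from B + D):
  a limit of twenties on a disjoint-pair wall lies on a mixed or Weyl face as well.
* MIXED walls `2δᵢ = δₖ+δₗ` and WEYL faces `δᵢ = δⱼ`: the first-order sieve PASSES (pattern `a·Eᵢᵢ − (a/2)(Eₖₗ+Eₗₖ)`, inertia
  (2,1): letters `k,l` asymptotically null, letter `i` indefinite and det-orthogonal to both) — `Stmt.stub_mixedWalls`,
  `Stmt.stub_weylFaces` are OPEN and need the second-order sieve (rank-3 Schur identity `G_CC = G_CB G_BB⁻¹ G_BC` on the blow-up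
  block); they are typed here so that provers can attack them face by face.
* INTERIOR: `Stmt.stub_chamberRigidity` («`T` is relatively closed in each open Sidon chamber») is the RESIDUAL DOOR — declared, not
  claimed easier: its `(2,4)` analogue is FALSE (the nine-count is not constant on the `(0,1,3,7)` chamber: `(0,1,3,20)` carries a
  nine, `(0,1,3,7)` is a proved eight — CONJECTURE.md v1.9.26), so at `(2,6)` it can only hold because twenties do not exist.
  The line's deliverables are the PERIPHERY laws; the interior is where `DoorA26` stays hard (census line / band laws / M4 rows).

WHY NOVEL (search-before-claim 2026-08-28, ids in `Lines/wall_bubbling.md`).  In the cell: Sidon confinement of `T` (tree), openness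
of `T` (tree), compactness normal form (tree), would-be-Gram INERTIA as a root-side certificate at FIXED support (THEOREM L7/L8,
lines `extremal_inverse`, `inverse_door`: located FALSE as a general law, SIG6), Lorentz TYPE words (`null_core`), lens/wrap counts
(`nappe_walk`), chamber census (`census`).  Nobody uses the CLOSEDNESS of the inertia cone under the root-scale congruence to
control DEGENERATIONS of twenties in EXPONENT space; the nearest literature object is the closure `E̅ₙ` of exponential sums by
extended sums `xʲe^{tx}` (Braess 1986, VI §1–2, VII §1: Descartes rule of Laguerre and its generalized signs) — scalar, no Gram
constraint.  Corroboration where the statement is NOT vacuous: at `(2,4)` the nine-locus is a nonempty open set and the only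
disjoint-pair wall `d₃ = d₁ + d₂` is flanked by the four `R(d) > 0` chambers (theory `R_signmap_2-4.txt`, `cluster_limit_K4.txt`),
which contain the proved deficient supports `(0,1,4,6)`, `(0,2,5,6)` (+ mirrors) hugging that wall — exactly what the pure-disjoint
wall law predicts; the mixed wall `2d₂ = d₃` is flanked by the `(0,1,3,7)` chamber where nines DO occur away from the wall.

BEARS ON: stmt-ValiantsHypothesis-19979 (DoorA26) directly; stmt-ValiantsHypothesis-18050 only through the `m = 2` rows of the
census (the Gram linearisation is special to `2 × 2`).

CHEAPEST FALSIFIER.  Of the lever: ONE realisable blow-up pattern at a pure-disjoint face (a nonzero symmetric `6 × 6` matrix of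
inertia `≤ (1,2)` or `≤ (2,1)` with vanishing pair-sum value-class sums at an injective `δ` without mixed coincidences) kills
`stub_pureDSieve` — decidable linear algebra, searched: 0 of 72 cases.  Of `stub_bubbling`: a family of DESCARTES-SHARP real
exponential sums (scalar, 21 terms, 20 zeros) whose exponents approach a single coincidence while NO root cluster develops the
cancelling pair-dominant profile — contradicts Cramer's rule at fixed roots and the cluster count in general; testable with the
inverse-door sampler (`Cruxes/DoorA26/Lines/inverse_door.md`) near `δ₃+δ₄ = δ₀+δ₅` on the hard support `(0,2,3,8,19,33)⁺`
(its one disjoint-type adjacency `34|05`, gap 6).  Of the whole line: a twenty (`Census.not_doorA26_iff`).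
INSTRUMENT / PRED-val-idea-15-1 (located, for the negative-side searchers): near a mixed wall `2dᵢ = dₖ + dₗ` every near-twenty must
show letters `k, l` near-null (|det Sₖ|, |det Sₗ| ≪ polar(Sₖ,Sₗ)) and letter `i` indefinite, det-orthogonal to both; near a
disjoint-pair wall no near-twenties at all (would-be Gram inertia `(≥2, ≥2)` forced, cf. SIG6 data of val-idea-4).

HONEST FRAMING.  A skeleton: three `sorry`s (obligations W, M, R), two discharged obligations (D, p610269; B, p619647 = module 8 of the chain p618256 · p618583 · p617041 · p617256 · p618712 · p618841 · p619271 · p619386 · p619647) and one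
kernel-checked composition; `DoorA26_proof` rests on the three `sorry`s.  `DoorA26` / `DoorA34` / `MatrixDescartes` OPEN; no summit statement is proved by this seat; VP ≠ VNP not moved.
-/

namespace Summit.ValiantsHypothesis.ValiantsHypothesis.Cruxes.DoorA26.WallBubbling

open Set Topology
open Summit.ValiantsHypothesis.ValiantsHypothesis.Theorems.LacunarySymmetroidMatrixDescartes.Census.RealExp

noncomputable section

/-- The open TWENTY-LOCUS `T ⊆ ℝ⁶` (literally the set of `isOpen_twentyLocus_two_six`). -/
def TwentyLocus : Set (Fin 6 → ℝ) :=
  {δ | ∃ S : Fin 6 → Matrix (Fin 2) (Fin 2) ℝ, (∀ l, (S l).IsSymm) ∧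
    20 ≤ {x : ℝ | 0 < x ∧ (∑ l, (x ^ (δ l)) • S l).det = 0}.ncard}

/-- The compact sorted simplex `0 = δ₀ ≤ δ₁ ≤ ⋯ ≤ δ₅ = 1` (normal form, `realRow_iff_simplex`). -/
def SortedSimplex : Set (Fin 6 → ℝ) := {δ | Monotone δ ∧ δ 0 = 0 ∧ δ (Fin.last 5) = 1}

/-- Weyl coincidence `δᵢ = δⱼ` (`i ≠ j`). -/
def HasWeylCoincidence (δ : Fin 6 → ℝ) : Prop := ∃ i j : Fin 6, i ≠ j ∧ δ i = δ j
/-- Mixed coincidence `2δᵢ = δₖ + δₗ` (`i, k, l` distinct): the pair sums of `(i,i)` and `(k,l)` collide. -/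
def HasMixedCoincidence (δ : Fin 6 → ℝ) : Prop :=
  ∃ i k l : Fin 6, i ≠ k ∧ i ≠ l ∧ k ≠ l ∧ 2 * δ i = δ k + δ l
/-- Disjoint-pair coincidence `δᵢ + δⱼ = δₖ + δₗ` (`i, j, k, l` distinct). -/
def HasDisjointCoincidence (δ : Fin 6 → ℝ) : Prop :=
  ∃ i j k l : Fin 6, i ≠ j ∧ i ≠ k ∧ i ≠ l ∧ j ≠ k ∧ j ≠ l ∧ k ≠ l ∧ δ i + δ j = δ k + δ l

/-- Polar form of `det` on `2 × 2` matrices: `det (∑ₗ cₗ Sₗ) = ∑ᵢⱼ cᵢ cⱼ · polar Sᵢ Sⱼ`. -/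
def polar (S T : Matrix (Fin 2) (Fin 2) ℝ) : ℝ := ((S + T).det - S.det - T.det) / 2

/-- `G` is (up to the global sign `f ↦ −f`) the GRAM MATRIX of six symmetric letters in `(Sym₂(ℝ), det) ≅ ℝ^{1,2}`;
equivalently `G` symmetric with inertia `(n₊,n₋) ≤ (1,2)` or `≤ (2,1)` — a CLOSED, congruence-invariant condition. -/
def Realisable (G : Matrix (Fin 6) (Fin 6) ℝ) : Prop :=
  ∃ (ε : ℝ) (S : Fin 6 → Matrix (Fin 2) (Fin 2) ℝ), (ε = 1 ∨ ε = -1) ∧ (∀ l, (S l).IsSymm) ∧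
    ∀ i j, G i j = ε * polar (S i) (S j)

/-- Every pair-sum VALUE class of `G` sums to zero: `∑_{δₖ+δₗ = v} G k l = 0` for all `v`
(ordered pairs; = the coefficient of `x^v` in `∑ₖₗ x^{δₖ+δₗ} Gₖₗ`).  A nonzero such `G` is a BLOW-UP PATTERN at `δ`. -/
def BlockSumsZero (δ : Fin 6 → ℝ) (G : Matrix (Fin 6) (Fin 6) ℝ) : Prop :=
  ∀ v : ℝ, (∑ k, ∑ l, if δ k + δ l = v then G k l else 0) = 0

/-! ## Typed obligations -/

/-- (W) `stub_weylFaces` — no accumulation of twenties at WEYL faces `δᵢ = δⱼ` of the sorted simplex (format drop to `(2,5)` plus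
confluent terms `x^E log x`).  OPEN: the first-order sieve passes (patterns `{(i,k),(j,k)}` are realisable); needs the second-order
sieve.  Why it might fail: an extended (2,5)-type configuration with five confluent blow-ups carrying 20 zeros in the limit.
Size L.  Implied by `DoorA26` (vacuous if `T = ∅`), does not imply it. -/
def Stmt.stub_weylFaces : Prop :=
  ∀ δ ∈ SortedSimplex, δ ∈ closure TwentyLocus → ¬ HasWeylCoincidence δ

/-- (M) `stub_mixedWalls` — no accumulation of twenties at MIXED walls `2δᵢ = δₖ + δₗ`.  OPEN: the first-order pattern
`a·Eᵢᵢ − (a/2)(Eₖₗ+Eₗₖ)` IS realisable (inertia (2,1): `Sₖ, Sₗ` null, `Sᵢ` indefinite ⟂ both; kernel-checked witness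
`pureDSieve_false_without_noMixed` in `Lines/wall_bubbling_PureDSieve.lean`), so the second-order sieve
(rank-3 Schur identity on the complement block + the window profile) is needed; at `(2,4)` the analogous wall `2d₂ = d₃` is hugged
only by proved eights (`(0,1,3,7)`, Schur theorems of the cell) — located support, not a proof.  Why it might fail: a genuine
second-order family of twenties degenerating onto a mixed wall of a hard chamber (1706: `02|11, 22|03, 33|04, 25|44, 44|35`).  Size L. -/
def Stmt.stub_mixedWalls : Prop :=
  ∀ δ ∈ SortedSimplex, δ ∈ closure TwentyLocus → ¬ HasMixedCoincidence δ

/-- (B) `stub_bubbling` — THE REDUCTION THEOREM: if twenties accumulate at a point of the sorted simplex with a pair-sum coincidence,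
some root cluster blows up and leaves a nonzero REALISABLE blow-up pattern (`BlockSumsZero ∧ Realisable`).  Proof sketch
(`Lines/wall_bubbling.md` §B): cluster the log-roots of the ν-th twenty (bounded mutual distance), rescale each cluster by its
dominant magnitude (a root-scale congruence of `G^ν`), pass to limits: non-degenerate clusters carry `≤ |Λ_c| − 1` zeros
(Laguerre–Descartes for exponential sums WITH multiplicity, Braess 1986 VI.1.1–1.2, + Hurwitz), consecutive clusters share
`≤ 1` limit exponent (slope monotonicity of the upper envelope), so with `≤ 20` distinct pair sums at `δ*` at most 19 zeros survive
unless a cluster limit vanishes identically — and that limit matrix is nonzero, realisable (closed cone) and has zero value-class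
sums.  Why it might fail: only through an error in the cluster bookkeeping (roots escaping between scales) — the statement is
classical in spirit (closure of exponential sums = extended exponential sums, Braess VI §2).  Size L (formalisation: Hurwitz for
real-analytic families on compact intervals is the long pole). -/
def Stmt.stub_bubbling : Prop :=
  ∀ δ ∈ SortedSimplex, δ ∈ closure TwentyLocus →
    (∃ i j k l : Fin 6, (i, j) ≠ (k, l) ∧ (i, j) ≠ (l, k) ∧ δ i + δ j = δ k + δ l) →
      ∃ G : Matrix (Fin 6) (Fin 6) ℝ, G ≠ 0 ∧ BlockSumsZero δ G ∧ Realisable G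

/-- (D) `stub_pureDSieve` — THE FINITE CERTIFICATE at pure disjoint-pair faces: at an injective `δ` with no mixed coincidence there is
NO nonzero realisable blow-up pattern.  PROVED AND LANDED: `Theorems/LacunarySymmetroidMatrixDescartesDoorA26WallBubblingPureDSieve.lean`
(p610269 ACCEPTED 2026-08-28T06:43Z; turnkey val-idea-15 g1, filed by prover-val-sym-door-p2-g9); the stub below is discharged by `exact`
(no `sorry`).  Argument (§D of the card): the classes of the diagonal
pairs `(i,i)` are singletons ⇒ `Gᵢᵢ = ±det Sᵢ = 0` ⇒ every active letter is `εᵢuᵢuᵢᵀ` ⇒ `Gₖₗ = ±εₖεₗ·½·det[uₖ uₗ]²`, zero iff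
`uₖ ∥ uₗ`; take the δ-top active letter `a` and the δ-top active letter `b` not parallel to `a`: the value class of `δ_a+δ_b`
contains no other pair with a nonzero entry ⇒ its class sum is `2G_ab ≠ 0`, contradiction.  Cross-check (located, exact
combinatorics): the 23 pure-D faces of the (2,6) arrangement, 72 (sub-union, support) cases, 0 realisable (`exp/sieveF.py`).
Why it might fail: it should not — this is the decidable part; a counter-pattern would be a 6×6 matrix found by linear algebra. -/
def Stmt.stub_pureDSieve : Prop :=
  ∀ δ : Fin 6 → ℝ, Function.Injective δ → ¬ HasMixedCoincidence δ →
    ∀ G : Matrix (Fin 6) (Fin 6) ℝ, BlockSumsZero δ G → Realisable G → G = 0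

/-- (R) `stub_chamberRigidity` — THE RESIDUAL DOOR, declared as such: inside the open Sidon chambers the twenty-locus is relatively
closed (equivalently: `T ∩ chamber` is clopen in the chamber, i.e. `T` is a union of whole open chambers).  NOT claimed easier than
`DoorA26`: its `(2,4)` analogue is false (nines on part of the `(0,1,3,7)` chamber only), so at `(2,6)` it can hold only because
`T = ∅`; an interior accumulation point is a multiplicity-twenty (one cluster) or a broken chain of window-sharp limits (several
clusters) — the objects of the census line's band laws and M4 rows.  Why it might fail: it fails iff twenties exist on part of a
chamber.  Size XL (= the door's core). -/
def Stmt.stub_chamberRigidity : Prop :=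
  ∀ δ ∈ SortedSimplex, δ ∈ closure TwentyLocus →
    ¬ HasWeylCoincidence δ → ¬ HasMixedCoincidence δ → ¬ HasDisjointCoincidence δ → δ ∈ TwentyLocus

/-! ## Stubs -/
theorem stub_weylFaces : Stmt.stub_weylFaces := by
  sorry
theorem stub_mixedWalls : Stmt.stub_mixedWalls := by
  sorry
/-- (B) DISCHARGED: `Theorems/LacunarySymmetroidMatrixDescartesDoorA26WallBubblingBubblingAssembly.lean` (p619647 = module 8 of the chain p618256 · p618583 · p617041 · p617256 · p618712 · p618841 · p619271 · p619386 · p619647; port by prover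
val-port-4 g1 of this seat's crux workfile `Lines/wall_bubbling_Assembly.lean`, modules Defs / TwistedRolle / Clusters / Config / Normalisation /
InertiaSpectral / InertiaClosed / Count / Assembly, namespace `…Theorems.LacunarySymmetroidMatrixDescartes.WallBubbling.Bubbling`) proves the
statement over textually identical copies of this file's definitions; the bridge below is definitional (no `sorry`).  The proof is multiplicity-free:
zero clusters at bounded mutual distance, one common subsequence, per-cluster normalisation by the dominant Gram entry, a ROBUST term count by
twisted Rolle against the LIMIT exponents (`robust_term_count'`), member-wise tropical monotonicity between clusters, the interval count
`Σ_c(|Λ_c| − 1) ≤ |V| − 1 ≤ 19` at a coincidence, hence a cluster whose limit has all class sums zero; that limit is nonzero, realisable (inertia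
`n₊ ≤ 1, n₋ ≤ 2` up to sign is closed) and has `BlockSumsZero`. -/
theorem stub_bubbling : Stmt.stub_bubbling := fun δ h₁ h₂ h₃ =>
  Summit.ValiantsHypothesis.ValiantsHypothesis.Theorems.LacunarySymmetroidMatrixDescartes.WallBubbling.Bubbling.stub_bubbling_proof
    δ h₁ h₂ h₃
/-- (D) DISCHARGED: `Theorems/LacunarySymmetroidMatrixDescartesDoorA26WallBubblingPureDSieve.lean` (p610269, ACCEPTED
2026-08-28T06:43Z; turnkey by this seat, filed by prover-val-sym-door-p2-g9) proves the statement with the line's definitions inlined. -/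
theorem stub_pureDSieve : Stmt.stub_pureDSieve := fun δ hδ hm G hB hR =>
  Summit.ValiantsHypothesis.ValiantsHypothesis.Theorems.LacunarySymmetroidMatrixDescartes.WallBubbling.pureDSieve
    δ hδ hm G hB hR
theorem stub_chamberRigidity : Stmt.stub_chamberRigidity := by
  sorry

/-! ## Composition (no sorry) -/

theorem isOpen_twentyLocus : IsOpen TwentyLocus := isOpen_twentyLocus_two_six

theorem convex_sortedSimplex : Convex ℝ SortedSimplex := by
  intro x hx y hy a b ha hb hab
  obtain ⟨hxm, hx0, hx1⟩ := hx
  obtain ⟨hym, hy0, hy1⟩ := hy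
  refine ⟨?_, ?_, ?_⟩
  · intro i j hij
    simp only [Pi.add_apply, Pi.smul_apply, smul_eq_mul]
    exact add_le_add (mul_le_mul_of_nonneg_left (hxm hij) ha) (mul_le_mul_of_nonneg_left (hym hij) hb)
  · show a * x 0 + b * y 0 = 0
    rw [hx0, hy0]; ring
  · show a * x (Fin.last 5) + b * y (Fin.last 5) = 1
    rw [hx1, hy1]; linarith

/-- The PURE-DISJOINT WALL LAW from (B) + (D): a limit of twenties on a disjoint-pair wall sits on a mixed or Weyl face too. -/
theorem pureDisjointWalls_of (hB : Stmt.stub_bubbling) (hD : Stmt.stub_pureDSieve) :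
    ∀ δ ∈ SortedSimplex, δ ∈ closure TwentyLocus → HasDisjointCoincidence δ →
      HasMixedCoincidence δ ∨ HasWeylCoincidence δ := by
  intro δ hΔ hcl hd
  by_contra h
  have hm : ¬ HasMixedCoincidence δ := fun hm => h (Or.inl hm)
  have hw : ¬ HasWeylCoincidence δ := fun hw => h (Or.inr hw)
  have hinj : Function.Injective δ := fun a b hab => by
    by_contra hne
    exact hw ⟨a, b, hne, hab⟩
  obtain ⟨i, j, k, l, hij, hik, hil, hjk, hjl, hkl, hsum⟩ := hd
  obtain ⟨G, hG0, hGs, hGr⟩ := hB δ hΔ hcl ⟨i, j, k, l,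
    fun h => hik (Prod.mk.inj h).1, fun h => hil (Prod.mk.inj h).1, hsum⟩
  exact hG0 (hD δ hinj hm G hGs hGr)

/-- Closure step: under the five obligations, `closure T ∩ Δ ⊆ T`. -/
theorem closure_subset_of (hW : Stmt.stub_weylFaces) (hM : Stmt.stub_mixedWalls) (hB : Stmt.stub_bubbling)
    (hD : Stmt.stub_pureDSieve) (hR : Stmt.stub_chamberRigidity) :
    ∀ δ ∈ SortedSimplex, δ ∈ closure TwentyLocus → δ ∈ TwentyLocus := by
  intro δ hΔ hcl
  have hw := hW δ hΔ hcl
  have hm := hM δ hΔ hcl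
  by_cases hd : HasDisjointCoincidence δ
  · rcases pureDisjointWalls_of hB hD δ hΔ hcl hd with h | h
    · exact absurd h hm
    · exact absurd h hw
  · exact hR δ hΔ hcl hw hm hd

/-- The wall point `(0,0,1,1,1,1)` of the simplex. -/
def wallPoint : Fin 6 → ℝ := ![0, 0, 1, 1, 1, 1]

theorem wallPoint_mem : wallPoint ∈ SortedSimplex := by
  refine ⟨?_, ?_, ?_⟩
  · refine Fin.monotone_iff_le_succ.mpr fun a => ?_
    fin_cases a <;> simp [wallPoint]
  · simp [wallPoint]
  · rfl

theorem wallPoint_weyl : HasWeylCoincidence wallPoint := ⟨0, 1, by decide, by simp [wallPoint]⟩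

/-- Clopen step: `T ∩ Δ` is relatively clopen in the convex `Δ` and misses the wall point, hence is empty. -/
theorem sortedSimplex_disjoint_twentyLocus (hW : Stmt.stub_weylFaces) (hM : Stmt.stub_mixedWalls)
    (hB : Stmt.stub_bubbling) (hD : Stmt.stub_pureDSieve) (hR : Stmt.stub_chamberRigidity) :
    ∀ δ ∈ SortedSimplex, δ ∉ TwentyLocus := by
  have hsub : SortedSimplex ⊆ (closure TwentyLocus)ᶜ := by
    refine convex_sortedSimplex.isPreconnected.subset_left_of_subset_union
      isClosed_closure.isOpen_compl isOpen_twentyLocus ?_ ?_ ?_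
    · exact disjoint_compl_left.mono_right subset_closure
    · intro δ hδ
      by_cases hc : δ ∈ closure TwentyLocus
      · exact Or.inr (closure_subset_of hW hM hB hD hR δ hδ hc)
      · exact Or.inl hc
    · exact ⟨wallPoint, wallPoint_mem, fun hc => hW wallPoint wallPoint_mem hc wallPoint_weyl⟩
  intro δ hδ hT
  exact hsub hδ (subset_closure hT)

/-- **COMPOSITION** (kernel-checked): the five obligations imply the crux `DoorA26` BY NAME. -/
theorem DoorA26_of (hW : Stmt.stub_weylFaces) (hM : Stmt.stub_mixedWalls) (hB : Stmt.stub_bubbling)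
    (hD : Stmt.stub_pureDSieve) (hR : Stmt.stub_chamberRigidity) :
    Summit.ValiantsHypothesis.ValiantsHypothesis.Theses.LacunarySymmetroid.DoorA26 := by
  refine (theses_doorA26_iff_rpow.trans (realRow_iff_simplex (m := 2) (k := 5) (B := 19))).mpr ?_
  intro δ hmono h0 h1 S hS
  by_contra hcon
  exact sortedSimplex_disjoint_twentyLocus hW hM hB hD hR δ ⟨hmono, h0, h1⟩ ⟨S, hS, Nat.lt_of_not_le hcon⟩

theorem DoorA26_proof : Summit.ValiantsHypothesis.ValiantsHypothesis.Theses.LacunarySymmetroid.DoorA26 :=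
  DoorA26_of stub_weylFaces stub_mixedWalls stub_bubbling stub_pureDSieve stub_chamberRigidity

end

end Summit.ValiantsHypothesis.ValiantsHypothesis.Cruxes.DoorA26.WallBubbling
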